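import Literature.NumberTheory.EllipticCurves.SelmerTorsionBaseChangeCongr
import Literature.NumberTheory.EllipticCurves.ShaRestriction
import HarnessLib

/-!
# Restriction on `H¹(·, E[n])` is transitive in a tower `k ⊂ K ⊂ L`

For an elliptic curve `W/k` and a tower of fields `k ⊂ K ⊂ L`, the tree's restriction maps
`resTorsion W K n : H¹(k, E[n]) → H¹(K, E_K[n])` (`SelmerTorsionRestriction.lean`) compose: restricting
from `k` to `K` and then from `K` to `L` is the restriction from `k` to `L`, read through the transport
`H¹(L, (E_K)_L[n]) ≃ H¹(L, E_L[n])` along `(W⁄K)⁄L = W⁄L` (`SelmerTorsionBaseChangeCongr.lean`). The three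
restrictions are built from three CHOSEN embeddings of algebraic closures (`closureEmb`); the composite
`k̄ → K̄ → L̄` differs from the chosen `k̄ → L̄` by an element `τ ∈ Γ_k` (`exists_algHom_eq_comp`), so the two
compatible pairs differ by the inner pair `(g ↦ τ⁻¹gτ, P ↦ τ • P)`, which acts trivially on `H¹(k, E[n])`
(Serre, *Corps locaux*, VII.§5, Prop. 3; the tree's `map_conj_one_eq_id`).

* `resH1Hom_conj_comp` — the map on `H¹` of a compatible pair precomposed with an inner pair is the map of
  the pair (the map-level form of the tree's `resKer_conj_comp`);
* `torsionBaseChangeMap_tower` — on coefficients, `E[n](k̄) → E_K[n](K̄) → (E_K)_L[n](L̄) = E_L[n](L̄)` is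
  `E[n](k̄) → E_L[n](L̄)` precomposed with `τ`;
* `resTorsion_resTorsion` — **transitivity**: `congr (res_{L/K} (res_{K/k} c)) = res_{L/k} c`.

Written for the `2`-Selmer kill layer of the BSD route `ShaPrimaryTransfer` (local Cassels uniformity: a
class over `ℚ` restricted to a completion `K_w` of the cubic field through `K` and through `ℚ_p` agree).

## References
* [SerreLocalFields1979] J.-P. Serre, *Local Fields*, GTM 67 (1979), VII.§5, Prop. 3.
* [SerreGaloisCohomology1997] J.-P. Serre, *Galois Cohomology* (1997), I.§2.4, II.§1.1.
-/

noncomputable section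

open scoped Classical

universe u

namespace Literature.NumberTheory.EllipticCurves

open CategoryTheory TopRep ContRepresentation ContinuousCohomology GaloisRepresentations WeierstrassCurve

/-! ## Inner pairs act trivially: map-level form -/

section Conj

variable {G : Type u} [Group G] [TopologicalSpace G] [IsTopologicalGroup G]
variable {M : Type u} [AddCommGroup M] [DistribMulAction G M] [TopologicalSpace M]
  [DiscreteTopology M]
variable {H : Type u} [Group H] [TopologicalSpace H] [IsTopologicalGroup H]
variable {N : Type u} [AddCommGroup N] [DistribMulAction H N] [TopologicalSpace N]
  [DiscreteTopology N]

/-- **Precomposing a compatible pair with an inner pair does not change the map on `H¹`**: for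
`(φ : H → G, ψ : M → N)` compatible and `τ ∈ G`, the pair `(τ⁻¹(φ ·)τ, ψ (τ • ·))` induces the same map
`H¹(G, M) → H¹(H, N)` (inner automorphisms act trivially on `H¹(G, M)`, the tree's `map_conj_one_eq_id`;
map-level form of `resKer_conj_comp`). [cite: SerreLocalFields1979, VII.§5 Prop. 3]
[cite: SerreGaloisCohomology1997, II.§1.1] -/
theorem resH1Hom_conj_comp (φ : H →ₜ* G) (ψ : M →+ N)
    (h : ∀ (x : H) (m : M), ψ (φ x • m) = x • ψ m) (τ : G)
    (h' : ∀ (x : H) (m : M), (ψ.comp (DistribSMul.toAddMonoidHom M τ)) ((conjCMH τ).comp φ x • m) =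
      x • (ψ.comp (DistribSMul.toAddMonoidHom M τ)) m) :
    resH1Hom ((conjCMH τ).comp φ) (ψ.comp (DistribSMul.toAddMonoidHom M τ)) h' = resH1Hom φ ψ h := by
  unfold resH1Hom
  have e : resHomOfEquivariant ((conjCMH τ).comp φ) (ψ.comp (DistribSMul.toAddMonoidHom M τ)) h' =
      (resFunctor (φ : H →* G)).map (actHom (discreteTopRep G M) τ) ≫ resHomOfEquivariant φ ψ h := by
    apply TopRep.hom_ext
    apply ContIntertwiningMap.ext
    ext m
    rfl
  have hmap : ContinuousCohomology.map ((conjCMH τ).comp φ)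
      (resHomOfEquivariant ((conjCMH τ).comp φ) (ψ.comp (DistribSMul.toAddMonoidHom M τ)) h') 1 =
      ContinuousCohomology.map φ (resHomOfEquivariant φ ψ h) 1 := by
    have hc := ContinuousCohomology.map_comp (conjCMH τ) φ (actHom (discreteTopRep G M) τ)
      (resHomOfEquivariant φ ψ h) 1
    rw [map_conj_one_eq_id, Category.id_comp] at hc
    rw [e]
    exact hc
  rw [hmap]

end Conj

/-! ## The tower -/

section Tower

variable {k : Type u} [Field k] {K : Type u} [Field K] {L : Type u} [Field L]
  [Algebra k K] [Algebra k L] [Algebra K L] [IsScalarTower k K L]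
  (W : WeierstrassCurve k) (n : ℤ)

/-- **Coefficients along the tower.** Let `ι₁ : k̄ → K̄`, `ι₂ : K̄ → L̄`, `ι₃ : k̄ → L̄` be the chosen embeddings and
`τ ∈ Γ_k` with `ι₂ ∘ ι₁ = ι₃ ∘ τ`. Then `E[n](k̄) → E_K[n](K̄) → (E_K)_L[n](L̄) = E_L[n](L̄)` (the tree's
`torsionBaseChangeMap` twice, then the transport along `(W⁄K)⁄L = W⁄L`) is `torsionBaseChangeMap W L n ∘ (τ • ·)`
— all maps being the identity, resp. the embeddings, on coordinates. [cite: SerreGaloisCohomology1997, II.§1.1] -/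
theorem torsionBaseChangeMap_tower (h : (W.baseChange K).baseChange L = W.baseChange L)
    (τ : AlgebraicClosure k ≃ₐ[k] AlgebraicClosure k)
    (hτ : ((closureEmb (K := K) L).restrictScalars k).comp (closureEmb (K := k) K) =
      (closureEmb (K := k) L).comp (τ : AlgebraicClosure k →ₐ[k] AlgebraicClosure k)) :
    (((torsionByCongr (geomPointsCongr h) n : geomTorsion ((W.baseChange K).baseChange L) n ≃+
        geomTorsion (W.baseChange L) n) :
        geomTorsion ((W.baseChange K).baseChange L) n →+ geomTorsion (W.baseChange L) n).comp
        (torsionBaseChangeMap (W.baseChange K) L n)).comp (torsionBaseChangeMap W K n) =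
      (torsionBaseChangeMap W L n).comp
        (DistribSMul.toAddMonoidHom (geomTorsion W n) (show Field.absoluteGaloisGroup k from τ)) := by
  have hτx : ∀ x : AlgebraicClosure k, closureEmb (K := K) L (closureEmb (K := k) K x) =
      closureEmb (K := k) L ((τ : AlgebraicClosure k →ₐ[k] AlgebraicClosure k) x) := fun x =>
    congrArg (fun f : AlgebraicClosure k →ₐ[k] AlgebraicClosure L => f x) hτ
  set τ' : Field.absoluteGaloisGroup k := τ with hτ'
  ext P
  -- compare underlying geometric points of `W⁄L`
  simp only [AddMonoidHom.coe_comp, Function.comp_apply, AddMonoidHom.coe_coe, coe_torsionByCongr_apply,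
    coe_torsionBaseChangeMap, DistribSMul.toAddMonoidHom_apply, AddSubgroup.torsionBy.coe_smul]
  -- the underlying point of `P`
  obtain ⟨P, hP⟩ := P
  change geomPointsCongr h (localPointsEquivGeomPoints (W.baseChange K) L (pointsMap (W.baseChange K) L
      (localPointsEquivGeomPoints W K (pointsMap W K P)))) =
    localPointsEquivGeomPoints W L (pointsMap W L
      (WeierstrassCurve.Affine.Point.map (τ : AlgebraicClosure k →ₐ[k] AlgebraicClosure k)
        (show (W.baseChange (AlgebraicClosure k)).toAffine.Point from P)))
  rcases P with _ | ⟨x, y, hxy⟩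
  · -- the point at infinity
    change geomPointsCongr h (localPointsEquivGeomPoints (W.baseChange K) L (pointsMap (W.baseChange K) L
        (localPointsEquivGeomPoints W K (pointsMap W K 0)))) =
      localPointsEquivGeomPoints W L (pointsMap W L (WeierstrassCurve.Affine.Point.map _ 0))
    rw [map_zero, map_zero, map_zero, map_zero, map_zero, map_zero]
    change (0 : geomPoints (W.baseChange L)) = localPointsEquivGeomPoints W L (pointsMap W L (0 : geomPoints W))
    rw [map_zero, map_zero]
  · -- an affine point: every map is the identity / the embedding on coordinates
    obtain ⟨h1, e1⟩ : ∃ h1, localPointsEquivGeomPoints W K (pointsMap W K (.some x y hxy)) =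
        (.some (closureEmb (K := k) K x) (closureEmb (K := k) K y) h1 : geomPoints (W.baseChange K)) := by
      change ∃ h', pointsCongr W K (AlgebraicClosure K)
        (WeierstrassCurve.Affine.Point.map (closureEmb (K := k) K) (.some x y hxy)) = _
      rw [WeierstrassCurve.Affine.Point.map_some, pointsCongr, WeierstrassCurve.Affine.Point.congrEquiv_some]
      exact ⟨_, rfl⟩
    obtain ⟨h2, e2⟩ : ∃ h2, localPointsEquivGeomPoints (W.baseChange K) L (pointsMap (W.baseChange K) L
        (.some (closureEmb (K := k) K x) (closureEmb (K := k) K y) h1 : geomPoints (W.baseChange K))) =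
        (.some (closureEmb (K := K) L (closureEmb (K := k) K x)) (closureEmb (K := K) L (closureEmb (K := k) K y)) h2 :
          geomPoints ((W.baseChange K).baseChange L)) := by
      change ∃ h', pointsCongr (W.baseChange K) L (AlgebraicClosure L)
        (WeierstrassCurve.Affine.Point.map (closureEmb (K := K) L) (.some _ _ h1)) = _
      rw [WeierstrassCurve.Affine.Point.map_some, pointsCongr, WeierstrassCurve.Affine.Point.congrEquiv_some]
      exact ⟨_, rfl⟩
    obtain ⟨h3, e3⟩ : ∃ h3, localPointsEquivGeomPoints W L (pointsMap W L
        (WeierstrassCurve.Affine.Point.map (τ : AlgebraicClosure k →ₐ[k] AlgebraicClosure k)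
          (show (W.baseChange (AlgebraicClosure k)).toAffine.Point from .some x y hxy))) =
        (.some (closureEmb (K := k) L ((τ : AlgebraicClosure k →ₐ[k] AlgebraicClosure k) x))
          (closureEmb (K := k) L ((τ : AlgebraicClosure k →ₐ[k] AlgebraicClosure k) y)) h3 :
          geomPoints (W.baseChange L)) := by
      change ∃ h', pointsCongr W L (AlgebraicClosure L)
        (WeierstrassCurve.Affine.Point.map (closureEmb (K := k) L)
          (WeierstrassCurve.Affine.Point.map (τ : AlgebraicClosure k →ₐ[k] AlgebraicClosure k) (.some x y hxy))) = _
      rw [WeierstrassCurve.Affine.Point.map_some, WeierstrassCurve.Affine.Point.map_some, pointsCongr,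
        WeierstrassCurve.Affine.Point.congrEquiv_some]
      exact ⟨_, rfl⟩
    rw [e1, e2, e3, geomPointsCongr_some]
    dsimp only
    change (WeierstrassCurve.Affine.Point.some _ _ _ : ((W.baseChange L).baseChange (AlgebraicClosure L)).toAffine.Point) =
      WeierstrassCurve.Affine.Point.some _ _ _
    rw [WeierstrassCurve.Affine.Point.some.injEq]
    exact ⟨hτx x, hτx y⟩

/-- **Restriction on `H¹(·, E[n])` is transitive in towers.** For `W/k` and a tower `k ⊂ K ⊂ L`:
transporting `res_{L/K} (res_{K/k} c)` along `(W⁄K)⁄L = W⁄L` gives `res_{L/k} c`, for every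
`c ∈ H¹(k, E[n])`. The two underlying compatible pairs differ by the inner pair of the `τ ∈ Γ_k` comparing the
composite embedding `k̄ → K̄ → L̄` with the chosen `k̄ → L̄` (`exists_algHom_eq_comp`,
`resGalOfEmb_comp_tower`, `resGalOfEmb_comp`), and inner pairs act trivially on `H¹`
(`resH1Hom_conj_comp`). [cite: SerreGaloisCohomology1997, II.§1.1] [cite: SerreLocalFields1979, VII.§5 Prop. 3] -/
theorem resTorsion_resTorsion (h : (W.baseChange K).baseChange L = W.baseChange L) (c : galH1Torsion W n) :
    h1Equiv (torsionByCongr (geomPointsCongr h) n) (torsionCongr_smul n h)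
        (resTorsion (W.baseChange K) L n (resTorsion W K n c)) = resTorsion W L n c := by
  obtain ⟨τ, hτ⟩ := exists_algHom_eq_comp (closureEmb (K := k) L)
    (((closureEmb (K := K) L).restrictScalars k).comp (closureEmb (K := k) K))
  rw [h1Equiv_apply, resTorsion, resTorsion, resTorsion, resH1Hom_resH1Hom, resH1Hom_resH1Hom]
  -- the Galois side: `res_{K/k} ∘ res_{L/K} = τ⁻¹ (res_{L/k} ·) τ`
  have hΦ : (resGal (K := k) K).comp ((resGal (K := K) L).comp
        (ContinuousMonoidHom.id (Field.absoluteGaloisGroup L))) =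
      (conjCMH (show Field.absoluteGaloisGroup k from τ)).comp (resGal (K := k) L) := by
    apply ContinuousMonoidHom.ext
    intro σ
    have e1 := congrArg (fun f : Field.absoluteGaloisGroup L →ₜ* Field.absoluteGaloisGroup k => f σ)
      (resGalOfEmb_comp_tower (closureEmb (K := k) K) (closureEmb (K := K) L))
    have e2 := congrArg (fun f : Field.absoluteGaloisGroup L →ₜ* Field.absoluteGaloisGroup k => f σ)
      (resGalOfEmb_comp (closureEmb (K := k) L) τ)
    simp only at e1 e2
    rw [hτ] at e1
    change ((resGalOfEmb (closureEmb (K := k) K)).comp (resGalOfEmb (K := K) (closureEmb (K := K) L))) σ =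
      ((conjCMH (show Field.absoluteGaloisGroup k from τ)).comp (resGalOfEmb (closureEmb (K := k) L))) σ
    rw [← e1, e2]
  -- the coefficient side
  have hΨ := torsionBaseChangeMap_tower W n h τ hτ
  set τ' : Field.absoluteGaloisGroup k := τ with hτ'
  have hcompat : ∀ (x : Field.absoluteGaloisGroup L) (P : geomTorsion W n),
      ((torsionBaseChangeMap W L n).comp (DistribSMul.toAddMonoidHom (geomTorsion W n) τ'))
          (((conjCMH τ').comp (resGal (K := k) L)) x • P) =
        x • ((torsionBaseChangeMap W L n).comp (DistribSMul.toAddMonoidHom (geomTorsion W n) τ')) P := by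
    intro x P
    simp only [ContinuousMonoidHom.comp_toFun, conjCMH_apply, AddMonoidHom.comp_apply,
      DistribSMul.toAddMonoidHom_apply, smul_smul, ← mul_assoc, mul_inv_cancel, one_mul]
    rw [mul_smul, torsionBaseChangeMap_smul]
  simp only [] at hΦ hΨ
  rw [resH1Hom_congr hΦ hΨ _ hcompat]
  exact congrFun (congrArg DFunLike.coe (resH1Hom_conj_comp (resGal (K := k) L) (torsionBaseChangeMap W L n)
    (torsionBaseChangeMap_smul W L n) τ' hcompat)) c

end Tower

end Literature.NumberTheory.EllipticCurves

end
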